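import Literature.AlgebraicTopology.KTheory.Exactness
import Literature.AlgebraicTopology.KTheory.WedgeCollapse
import Literature.AlgebraicTopology.KTheory.CoverTrivial
import Literature.AlgebraicTopology.KTheory.GLHomotopyExtension
import Literature.AlgebraicTopology.KTheory.BottSpectral
import Literature.LinearAlgebra.Matrix.GLPathConnected
import HarnessLib

/-!
# Collapsing a closed contractible subspace: `K⁰(X/A) ≅ K⁰(X)`

Husemöller, *Fibre Bundles*, Ch. 10 Prop. 2.1 (last clause; = Hatcher, *Vector Bundles and
K-Theory*, Lemma 2.10): for a compact Hausdorff space `X` and a closed **contractible** subspace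
`A`, pull-back along the collapse map `mk : X → X/A` (`Collapse X A`) is an isomorphism
`quotKEquiv : K⁰(X/A) ≃+ K⁰(X)` (and identifies reduced groups, `quotK_mem_reduced_iff`). The
source states it for finite CW pairs; the proof here is for compact Hausdorff `X`, in the
idempotent-matrix model:

* *surjectivity on idempotents* (`exists_idem_collapse_of_contractible`): an idempotent over `X`
  is trivial over the contractible `A` (`CoverTrivial`), hence descends (`Exactness`);
* *injectivity on idempotents* (`algEquivalent_of_algEquivalent_map_mk`): an equivalence
  `(x, y)` over `X` between two descended idempotents restricts over `A` to `x = u x₀` with `u`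
  invertible and commuting with the constant value `E₁` (`torsor_identities`); `u` is
  null-homotopic through such matrices (`exists_nullhomotopy_glComm`, using contractibility and
  the polynomial path in `GLₙ(ℂ)`), the null-homotopy extends to an invertible `W` over
  `X × [0,1]` (`exists_extension_prod`, from `GLHomotopyExtension`), the conjugated family
  `W⁻¹ q₁ W` descends to `X/A × [0,1]` (`descendIMat`), so by homotopy invariance `q₁` is
  equivalent to the descent of `W₁⁻¹ q₁ W₁`, which is equivalent to `q₂` via the descended
  equivalence `(W₁⁻¹ x, y W₁)` (constant on `A`).

Everything is proved; no named facts.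

## References

* D. Husemöller, *Fibre Bundles*, 3rd ed. (1994) [HusemollerFibreBundles1994]: Ch. 10 Prop. 2.1.
* A. Hatcher, *Vector Bundles and K-Theory* (v2.2, 2017), Lemma 2.10 (same statement and proof
  idea for compact Hausdorff pairs; not held, cited for orientation only).
-/

noncomputable section

open Set unitInterval Topology TopologicalSpace

namespace Literature.AlgebraicTopology.KTheory

open Literature.RingTheory.KTheory Matrix Literature.LinearAlgebra.Matrix

universe u

variable {X : Type u} [TopologicalSpace X] [CompactSpace X] [T2Space X] {A : Closeds X}

/-! ### Surjectivity: every idempotent over `X` comes from `X/A` when `A` is contractible -/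

/-- **Every idempotent over `X` is equivalent to one pulled back from `X/A`** (`A` closed and
contractible): the bundle is trivial over `A`, so it descends. [cite: HusemollerFibreBundles1994, Ch. 10 Prop. 2.1] -/
theorem exists_idem_collapse_of_contractible [ContractibleSpace (A : Set X)] (P : Idem C(X, ℂ)) :
    ∃ q : Idem C(Collapse X A, ℂ), AlgEquivalent (q.mat.map (comapRingHom (Collapse.mk A))) P.mat := by
  obtain ⟨a₀⟩ := (inferInstance : Nonempty (A : Set X))
  haveI : CompactSpace (A : Set X) := isCompact_iff_compactSpace.1 A.isClosed.isCompact
  have h := algEquivalent_one_of_contractible a₀ (P.map (resHom (A : Set X)))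
  rw [← Matrix.map_one (constRingHom (A : Set X)) (map_zero _) (map_one _)] at h
  obtain ⟨q, hq, -⟩ := exists_idem_collapse_of_algEquivalent_const (A := A) P.isIdempotentElem IsIdempotentElem.one h
  exact ⟨q, hq⟩

/-! ### Paths of invertible matrices commuting with a fixed matrix -/

/-- The polynomial path from `1` to an invertible `g` stays in the commutant of anything `g`
commutes with. [folklore] -/
theorem joinedIn_isUnit_det_one_commute {n : Type*} [Fintype n] [DecidableEq n] (g E : Matrix n n ℂ) (hg : IsUnit g.det)
    (hgE : g * E = E * g) : JoinedIn {M : Matrix n n ℂ | IsUnit M.det ∧ M * E = E * M} 1 g := by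
  set Z : Set ℂ := {s | ((linePoly g).det).IsRoot s}
  have hZ : Z.Finite := Polynomial.finite_setOf_isRoot (det_linePoly_ne_zero g)
  have hconn : IsPathConnected Zᶜ := by
    refine hZ.countable.isPathConnected_compl_of_one_lt_rank ?_
    rw [← Module.finrank_eq_rank, Complex.finrank_real_complex]; norm_num
  have h0 : (0 : ℂ) ∈ Zᶜ := by
    simp only [Z, mem_compl_iff, mem_setOf_eq, Polynomial.IsRoot.def, eval_det_linePoly]; simp
  have h1 : (1 : ℂ) ∈ Zᶜ := by
    simp only [Z, mem_compl_iff, mem_setOf_eq, Polynomial.IsRoot.def, eval_det_linePoly]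
    simpa using hg.ne_zero
  obtain ⟨γ, hγ⟩ := hconn.joinedIn 0 h0 1 h1
  let F : C(ℂ, Matrix n n ℂ) := ⟨fun s ↦ (1 - s) • (1 : Matrix n n ℂ) + s • g, by fun_prop⟩
  refine ⟨⟨⟨fun t ↦ F (γ t), F.continuous.comp γ.continuous⟩, by simp [F], by simp [F]⟩, fun t ↦ ⟨?_, ?_⟩⟩
  · have ht := hγ t
    simp only [Z, mem_compl_iff, mem_setOf_eq, Polynomial.IsRoot.def, eval_det_linePoly] at ht
    exact isUnit_iff_ne_zero.2 ht
  · change ((1 - γ t) • (1 : Matrix n n ℂ) + γ t • g) * E = E * ((1 - γ t) • (1 : Matrix n n ℂ) + γ t • g)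
    rw [Matrix.add_mul, Matrix.mul_add, Matrix.smul_mul, Matrix.mul_smul, Matrix.smul_mul, Matrix.mul_smul, Matrix.one_mul, Matrix.mul_one, hgE]

/-! ### From an equivalence between constant idempotents to an invertible matrix function -/

section Torsor

variable {R : Type*} [Ring R] {n₁ n₂ : Type*} [Fintype n₁] [Fintype n₂] [DecidableEq n₁] [DecidableEq n₂]

omit [DecidableEq n₂] in
/-- Given two normalised equivalences `(x, y)` and `(x₀, y₀)` between the same idempotents
`E₁ = x y = x₀ y₀`, `E₂ = y x = y₀ x₀`, the element `u = x y₀ + (1 - E₁)` is a unit with inverse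
`x₀ y + (1 - E₁)`, commutes with `E₁`, and `x = u x₀`, `y = y₀ u⁻¹`. [folklore] -/
theorem torsor_identities {x x₀ : Matrix n₁ n₂ R} {y y₀ : Matrix n₂ n₁ R} {E₁ : Matrix n₁ n₁ R} {E₂ : Matrix n₂ n₂ R}
    (hxy : x * y = E₁) (hyx : y * x = E₂) (hx : x * y * x = x) (hy : y * x * y = y)
    (hxy₀ : x₀ * y₀ = E₁) (hyx₀ : y₀ * x₀ = E₂) (hx₀ : x₀ * y₀ * x₀ = x₀) (hy₀ : y₀ * x₀ * y₀ = y₀) :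
    (x * y₀ + (1 - E₁)) * (x₀ * y + (1 - E₁)) = 1 ∧ (x₀ * y + (1 - E₁)) * (x * y₀ + (1 - E₁)) = 1 ∧
    E₁ * (x * y₀ + (1 - E₁)) = (x * y₀ + (1 - E₁)) * E₁ ∧ (x * y₀ + (1 - E₁)) * x₀ = x ∧ y₀ * (x₀ * y + (1 - E₁)) = y := by
  have hE : E₁ * E₁ = E₁ := by rw [← hxy, ← Matrix.mul_assoc, hx]
  have e1 : (1 - E₁) * (1 - E₁) = 1 - E₁ := by rw [Matrix.mul_sub, Matrix.sub_mul, Matrix.one_mul, Matrix.mul_one, Matrix.sub_mul, Matrix.one_mul, hE, sub_self, sub_zero]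
  have hEx : E₁ * x = x := by rw [← hxy, hx]
  have hEx₀ : E₁ * x₀ = x₀ := by rw [← hxy₀, hx₀]
  have hyE : y * E₁ = y := by rw [← hxy, ← Matrix.mul_assoc, hy]
  have hy₀E : y₀ * E₁ = y₀ := by rw [← hxy₀, ← Matrix.mul_assoc, hy₀]
  have hxE₂ : x * E₂ = x := by rw [← hyx, ← Matrix.mul_assoc, hx]
  have hx₀E₂ : x₀ * E₂ = x₀ := by rw [← hyx₀, ← Matrix.mul_assoc, hx₀]
  have hE₂y : E₂ * y = y := by rw [← hyx]; exact hy
  refine ⟨?_, ?_, ?_, ?_, ?_⟩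
  · rw [Matrix.add_mul, Matrix.mul_add, Matrix.mul_add, Matrix.mul_assoc x y₀ (x₀ * y), ← Matrix.mul_assoc y₀, hyx₀, ← Matrix.mul_assoc, hxE₂, hxy,
      Matrix.mul_sub, Matrix.mul_one, Matrix.mul_assoc, hy₀E, sub_self, add_zero, Matrix.sub_mul, Matrix.one_mul, ← Matrix.mul_assoc, hEx₀, sub_self,
      zero_add, e1, add_sub_cancel]
  · rw [Matrix.add_mul, Matrix.mul_add, Matrix.mul_add, Matrix.mul_assoc x₀ y (x * y₀), ← Matrix.mul_assoc y, hyx, ← Matrix.mul_assoc, hx₀E₂, hxy₀,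
      Matrix.mul_sub, Matrix.mul_one, Matrix.mul_assoc, hyE, sub_self, add_zero, Matrix.sub_mul, Matrix.one_mul, ← Matrix.mul_assoc, hEx, sub_self,
      zero_add, e1, add_sub_cancel]
  · rw [Matrix.mul_add, Matrix.add_mul, ← Matrix.mul_assoc, hEx, Matrix.mul_assoc x y₀ E₁, hy₀E, Matrix.mul_sub, Matrix.sub_mul, Matrix.mul_one, Matrix.one_mul, hE]
  · rw [Matrix.add_mul, Matrix.mul_assoc, hyx₀, hxE₂, Matrix.sub_mul, Matrix.one_mul, hEx₀, sub_self, add_zero]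
  · rw [Matrix.mul_add, ← Matrix.mul_assoc, hyx₀, hE₂y, Matrix.mul_sub, Matrix.mul_one, hy₀E, sub_self, add_zero]

end Torsor

/-! ### A null-homotopy inside the commutant, and its extension over `X × [0,1]` -/

section NullHomotopy

variable {n : Type*} [Fintype n] [DecidableEq n]

/-- The predicate "invertible and commuting with `E`" on matrix-valued maps. [folklore] -/
def GLComm {Y : Type*} [TopologicalSpace Y] (E : Matrix n n ℂ) (g : C(Y, Matrix n n ℂ)) : Prop :=
  ∀ y, IsUnit (g y).det ∧ g y * E = E * g y

/-- **On a compact contractible space, an invertible matrix function commuting with `E` is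
null-homotopic through such functions.** [folklore] -/
theorem exists_nullhomotopy_glComm {Y : Type*} [TopologicalSpace Y] [ContractibleSpace Y] (E : Matrix n n ℂ) (u : C(Y, Matrix n n ℂ))
    (hu : GLComm E u) :
    ∃ k : C(Y × I, Matrix n n ℂ), (∀ y, k (y, 0) = 1) ∧ (∀ y, k (y, 1) = u y) ∧ ∀ y t, IsUnit (k (y, t)).det ∧ k (y, t) * E = E * k (y, t) := by
  obtain ⟨y₀⟩ := (inferInstance : Nonempty Y)
  -- piece 1: a path from `1` to `u y₀` in the commutant
  obtain ⟨γ, hγ⟩ := joinedIn_isUnit_det_one_commute (u y₀) E (hu y₀).1 (hu y₀).2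
  let F₁ : ContinuousMap.HomotopyWith (ContinuousMap.const Y (1 : Matrix n n ℂ)) (ContinuousMap.const Y (u y₀)) (GLComm E) :=
    { toFun := fun z ↦ γ z.1
      continuous_toFun := γ.continuous.comp continuous_fst
      map_zero_left := fun y ↦ by simp
      map_one_left := fun y ↦ by simp
      prop' := fun t y ↦ hγ t }
  -- piece 2: contracting `Y`
  obtain ⟨H⟩ := homotopic_of_contractibleSpace (ContinuousMap.id Y) (ContinuousMap.const Y y₀)
  let F₂ : ContinuousMap.HomotopyWith (ContinuousMap.const Y (u y₀)) u (GLComm E) :=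
    { toFun := fun z ↦ u (H (σ z.1, z.2))
      continuous_toFun := by fun_prop
      map_zero_left := fun y ↦ by simp
      map_one_left := fun y ↦ by simp
      prop' := fun t y ↦ hu _ }
  let F := F₁.trans F₂
  refine ⟨⟨fun z ↦ F (z.2, z.1), by fun_prop⟩, fun y ↦ F.apply_zero y, fun y ↦ F.apply_one y, fun y t ↦ F.prop t y⟩

/-- **Extension over `X × [0,1]`** of a commutant null-homotopy given on `A × [0,1]`: an invertible
matrix function `𝒲` on `X × [0,1]` agreeing with `k` on `A × [0,1]`. [folklore] -/
theorem exists_extension_prod (k : C((↥(A : Set X)) × I, Matrix n n ℂ)) (hk0 : ∀ a, k (a, 0) = 1) (hk : ∀ a t, IsUnit (k (a, t)).det) :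
    ∃ W : C(X × I, Matrix n n ℂ), (∀ z, IsUnit (W z).det) ∧ ∀ (a : ↥(A : Set X)) (t : I), W ((a : X), t) = k (a, t) := by
  have hB : IsClosed ((A : Set X) ×ˢ (univ : Set I)) := A.isClosed.prod isClosed_univ
  -- the null-homotopy `h(b, s) = k(a, (1 - s) t)` on `B = A × I`
  let e : ↥((A : Set X) ×ˢ (univ : Set I)) → (↥(A : Set X)) × I := fun b ↦ (⟨b.1.1, b.2.1⟩, b.1.2)
  have he : Continuous e := by fun_prop
  let h : C(↥((A : Set X) ×ˢ (univ : Set I)) × I, Matrix n n ℂ) :=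
    ⟨fun bs ↦ k ((e bs.1).1, σ bs.2 * (e bs.1).2), by fun_prop⟩
  obtain ⟨W, hW, hWB⟩ := exists_extension_of_nullhomotopic hB h (fun bs ↦ hk _ _) (fun b ↦ by
    change k ((e b).1, σ 1 * (e b).2) = 1
    rw [unitInterval.symm_one, zero_mul]; exact hk0 _)
  refine ⟨W, hW, fun a t ↦ ?_⟩
  have := hWB ⟨((a : X), t), a.2, mem_univ _⟩
  rw [this]
  change k (⟨a, _⟩, σ 0 * t) = k (a, t)
  rw [unitInterval.symm_zero, one_mul]

end NullHomotopy

/-! ### Descent along `mk × id : X × [0,1] → X/A × [0,1]` -/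

section DescendI

/-- Descend a function on `X × [0,1]` which is constant along `A × {t}` for every `t`. [folklore] -/
def descendI (F : C(X × I, ℂ)) (a₀ : X) (hF : ∀ a ∈ A, ∀ t : I, F (a, t) = F (a₀, t)) : C(Collapse X A × I, ℂ) :=
  (Collapse.lift F.curry (F.curry a₀) (fun a ha ↦ by ext t; exact hF a ha t)).uncurry

omit [CompactSpace X] [T2Space X] in
/-- Auxiliary statement for collapsing a contractible subspace. [folklore] -/
@[simp] theorem descendI_mk (F : C(X × I, ℂ)) (a₀ : X) (hF) (x : X) (t : I) : descendI (A := A) F a₀ hF (Collapse.mk A x, t) = F (x, t) := rfl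

omit [CompactSpace X] [T2Space X] in
/-- Auxiliary statement for collapsing a contractible subspace. [folklore] -/
@[simp] theorem descendI_pt (F : C(X × I, ℂ)) (a₀ : X) (hF) (t : I) : descendI (A := A) F a₀ hF (Collapse.pt A, t) = F (a₀, t) := rfl

variable (A) in
/-- `mk × id`. [folklore] -/
def mkI : C(X × I, Collapse X A × I) := (Collapse.mk A).prodMap (ContinuousMap.id I)

omit [CompactSpace X] [T2Space X] in
/-- Matrices over `X/A × [0,1]` are determined by their pullbacks along `mk × id` and their values over `pt × [0,1]`. [folklore] -/
theorem matrix_eq_of_map_mkI_eq {m m' : Type*} {M N : Matrix m m' C(Collapse X A × I, ℂ)}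
    (h : M.map (comapRingHom (mkI A)) = N.map (comapRingHom (mkI A))) (hpt : ∀ t : I, M.map (evalRingHom (Collapse.pt A, t)) = N.map (evalRingHom (Collapse.pt A, t))) :
    M = N := by
  ext i j ⟨z, t⟩ : 3
  rcases Collapse.eq_pt_or_eq_mk z with rfl | ⟨x, -, rfl⟩
  · exact congrFun (congrFun (hpt t) i) j
  · exact congrFun (congrArg DFunLike.coe (congrFun (congrFun h i) j)) (x, t)

/-- Descend a matrix of functions on `X × [0,1]`, constant along `A × {t}`. [folklore] -/
def descendIMat {m m' : Type*} (M : Matrix m m' C(X × I, ℂ)) (a₀ : X) (hM : ∀ i j, ∀ a ∈ A, ∀ t : I, M i j (a, t) = M i j (a₀, t)) :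
    Matrix m m' C(Collapse X A × I, ℂ) :=
  Matrix.of fun i j ↦ descendI (M i j) a₀ (hM i j)

omit [CompactSpace X] [T2Space X] in
/-- Auxiliary statement for collapsing a contractible subspace. [folklore] -/
theorem descendIMat_map_mkI {m m' : Type*} (M : Matrix m m' C(X × I, ℂ)) (a₀ : X) (hM) :
    (descendIMat (A := A) M a₀ hM).map (comapRingHom (mkI A)) = M := by
  ext i j ⟨x, t⟩ : 3; rfl

omit [CompactSpace X] [T2Space X] in
/-- Auxiliary statement for collapsing a contractible subspace. [folklore] -/
theorem descendIMat_map_eval_pt {m m' : Type*} (M : Matrix m m' C(X × I, ℂ)) (a₀ : X) (hM) (t : I) :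
    (descendIMat (A := A) M a₀ hM).map (evalRingHom (Collapse.pt A, t)) = M.map (evalRingHom (a₀, t)) := by
  ext i j : 2; rfl

omit [CompactSpace X] [T2Space X] in
/-- Descent along `mk × id` preserves idempotency. [folklore] -/
theorem isIdempotentElem_descendIMat {m : Type*} [Fintype m] {M : Matrix m m C(X × I, ℂ)} (hM : IsIdempotentElem M) (a₀ : X) (h) :
    IsIdempotentElem (descendIMat (A := A) M a₀ h) :=
  matrix_eq_of_map_mkI_eq (by rw [Matrix.map_mul, descendIMat_map_mkI, hM.eq])
    (fun t ↦ by rw [Matrix.map_mul, descendIMat_map_eval_pt, ← Matrix.map_mul, hM.eq])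

omit [CompactSpace X] [T2Space X] in
/-- Slices of a descended family pull back along `mk` to slices of the original family. [folklore] -/
theorem descendIMat_slice_map_mk {m m' : Type*} (M : Matrix m m' C(X × I, ℂ)) (a₀ : X) (hM) (t : I) :
    ((descendIMat (A := A) M a₀ hM).map (comapRingHom (sliceIncl t))).map (comapRingHom (Collapse.mk A)) = M.map (comapRingHom (sliceIncl t)) := by
  ext i j x : 3; rfl

omit [CompactSpace X] [T2Space X] in
/-- Auxiliary statement for collapsing a contractible subspace. [folklore] -/
theorem descendIMat_slice_map_eval_pt {m m' : Type*} (M : Matrix m m' C(X × I, ℂ)) (a₀ : X) (hM) (t : I) :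
    ((descendIMat (A := A) M a₀ hM).map (comapRingHom (sliceIncl t))).map (evalRingHom (Collapse.pt A)) = M.map (evalRingHom (a₀, t)) := by
  ext i j : 2; rfl

end DescendI

/-! ### Injectivity on idempotents -/

section Injective

omit [CompactSpace X] [T2Space X] in
/-- Auxiliary statement for collapsing a contractible subspace. [folklore] -/
theorem map_mk_map_eval {m m' : Type*} (M : Matrix m m' C(Collapse X A, ℂ)) {a : X} (ha : a ∈ A) :
    (M.map (comapRingHom (Collapse.mk A))).map (evalRingHom a) = M.map (evalRingHom (Collapse.pt A)) := by
  rw [Matrix.map_map]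
  congr 1
  funext f
  change f (Collapse.mk A a) = f (Collapse.pt A)
  rw [Collapse.mk_eq_pt ha]

omit [CompactSpace X] [T2Space X] in
/-- Conjugate idempotent matrices are equivalent. [folklore] -/
theorem algEquivalent_conj' {R : Type*} [Ring R] {m : Type*} [Fintype m] [DecidableEq m] {P c d : Matrix m m R} (hP : IsIdempotentElem P) (hcd : c * d = 1) :
    AlgEquivalent (d * P * c) P := by
  refine ⟨d * P, P * c, ?_, ?_, ?_, ?_⟩
  · rw [Matrix.mul_assoc d P (P * c), ← Matrix.mul_assoc P P c, hP.eq, Matrix.mul_assoc]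
  · rw [Matrix.mul_assoc P c (d * P), ← Matrix.mul_assoc c d P, hcd, Matrix.one_mul, hP.eq]
  · calc d * P * (P * c) * (d * P) = d * (P * P) * (c * d) * P := by simp only [Matrix.mul_assoc]
      _ = d * P := by rw [hP.eq, hcd, Matrix.mul_one, Matrix.mul_assoc, hP.eq]
  · calc P * c * (d * P) * (P * c) = P * (c * d) * (P * P) * c := by simp only [Matrix.mul_assoc]
      _ = P * c := by rw [hcd, Matrix.mul_one, hP.eq, hP.eq]

/-- **Injectivity of `mk^*` on idempotents when `A` is contractible**: idempotents over `X/A`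
whose pull-backs to `X` are equivalent are equivalent. [cite: HusemollerFibreBundles1994, Ch. 10 Prop. 2.1] -/
theorem algEquivalent_of_algEquivalent_map_mk [ContractibleSpace (A : Set X)] (q₁ q₂ : Idem C(Collapse X A, ℂ))
    (h : AlgEquivalent (q₁.mat.map (comapRingHom (Collapse.mk A))) (q₂.mat.map (comapRingHom (Collapse.mk A)))) :
    AlgEquivalent q₁.mat q₂.mat := by
  obtain ⟨⟨a₀, ha₀⟩⟩ := (inferInstance : Nonempty (A : Set X))
  obtain ⟨x, y, hxy, hyx, hx, hy⟩ := h
  -- notation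
  let φ := comapRingHom (Collapse.mk A)
  let ρ := resHom (A : Set X)
  let E₁ := q₁.mat.map (evalRingHom (Collapse.pt A))
  let E₂ := q₂.mat.map (evalRingHom (Collapse.pt A))
  let x₀ := x.map (evalRingHom a₀)
  let y₀ := y.map (evalRingHom a₀)
  have hE₁ : IsIdempotentElem E₁ := q₁.isIdempotentElem.map (RingHom.mapMatrix (evalRingHom (Collapse.pt A)))
  -- evaluations at `a₀`
  have hxy₀ : x₀ * y₀ = E₁ := by rw [← Matrix.map_mul, hxy, map_mk_map_eval _ ha₀]
  have hyx₀ : y₀ * x₀ = E₂ := by rw [← Matrix.map_mul, hyx, map_mk_map_eval _ ha₀]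
  have hx₀ : x₀ * y₀ * x₀ = x₀ := by rw [← Matrix.map_mul, ← Matrix.map_mul, hx]
  have hy₀ : y₀ * x₀ * y₀ = y₀ := by rw [← Matrix.map_mul, ← Matrix.map_mul, hy]
  -- restrictions to `A`
  have hxyA : x.map ρ * y.map ρ = E₁.map (constRingHom (A : Set X)) := by rw [← Matrix.map_mul, hxy, map_mk_map_resHom A]
  have hyxA : y.map ρ * x.map ρ = E₂.map (constRingHom (A : Set X)) := by rw [← Matrix.map_mul, hyx, map_mk_map_resHom A]
  have hxA : x.map ρ * y.map ρ * x.map ρ = x.map ρ := by rw [← Matrix.map_mul, ← Matrix.map_mul, hx]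
  have hyA : y.map ρ * x.map ρ * y.map ρ = y.map ρ := by rw [← Matrix.map_mul, ← Matrix.map_mul, hy]
  have hxy₀A : x₀.map (constRingHom (A : Set X)) * y₀.map (constRingHom (A : Set X)) = E₁.map (constRingHom (A : Set X)) := by rw [← Matrix.map_mul, hxy₀]
  have hyx₀A : y₀.map (constRingHom (A : Set X)) * x₀.map (constRingHom (A : Set X)) = E₂.map (constRingHom (A : Set X)) := by rw [← Matrix.map_mul, hyx₀]
  have hx₀A : x₀.map (constRingHom (A : Set X)) * y₀.map (constRingHom (A : Set X)) * x₀.map (constRingHom (A : Set X)) = x₀.map (constRingHom (A : Set X)) := by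
    rw [← Matrix.map_mul, ← Matrix.map_mul, hx₀]
  have hy₀A : y₀.map (constRingHom (A : Set X)) * x₀.map (constRingHom (A : Set X)) * y₀.map (constRingHom (A : Set X)) = y₀.map (constRingHom (A : Set X)) := by
    rw [← Matrix.map_mul, ← Matrix.map_mul, hy₀]
  obtain ⟨huu', hu'u, hEu, hux₀, hy₀u'⟩ := torsor_identities hxyA hyxA hxA hyA hxy₀A hyx₀A hx₀A hy₀A
  set u := x.map ρ * y₀.map (constRingHom (A : Set X)) + (1 - E₁.map (constRingHom (A : Set X))) with hu_def
  set u' := x₀.map (constRingHom (A : Set X)) * y.map ρ + (1 - E₁.map (constRingHom (A : Set X))) with hu'_def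
  have hUnit : IsUnit u := ⟨⟨u, u', huu', hu'u⟩, rfl⟩
  -- (S1) `u` as a matrix-valued function on `A`, invertible and commuting with `E₁`
  have hconst : ∀ (M : Matrix (Fin q₁.size) (Fin q₁.size) ℂ) (a : (A : Set X)), (M.map (constRingHom (A : Set X))).map (evalRingHom a) = M :=
    fun M a ↦ by ext i j; rfl
  have hGL : GLComm E₁ (matrixSwap u) := fun a ↦ by
    have e : matrixSwap u a = u.map (evalRingHom a) := rfl
    refine ⟨?_, ?_⟩
    · rw [e, ← Matrix.isUnit_iff_isUnit_det]; exact hUnit.map (RingHom.mapMatrix _)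
    · rw [e, ← hconst E₁ a, ← Matrix.map_mul, ← Matrix.map_mul, hEu]
  -- (S2) null-homotopy of `u` in the commutant, (S3) extension over `X × [0,1]`
  obtain ⟨k, hk0, hk1, hk⟩ := exists_nullhomotopy_glComm E₁ (matrixSwap u) hGL
  obtain ⟨W, hWdet, hWk⟩ := exists_extension_prod (A := A) k hk0 (fun a t ↦ (hk a t).1)
  -- (S4) as a unit matrix over `C(X × [0,1], ℂ)`
  have hWu : IsUnit (matrixUnswap W) := isUnit_of_forall_isUnit_evalAt _ fun z ↦ (Matrix.isUnit_iff_isUnit_det _).2 (hWdet z)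
  obtain ⟨U, hU⟩ := hWu
  let Um : Matrix (Fin q₁.size) (Fin q₁.size) C(X × I, ℂ) := ↑U
  let Ui : Matrix (Fin q₁.size) (Fin q₁.size) C(X × I, ℂ) := ↑U⁻¹
  have hUU : Um * Ui = 1 := U.mul_inv
  have hUU' : Ui * Um = 1 := U.inv_mul
  have hUz : ∀ z, evalAt Um z = W z := fun z ↦ by change evalAt (↑U : Matrix _ _ C(X × I, ℂ)) z = W z; rw [hU]; rfl
  have hUinvz : ∀ z, evalAt Ui z = (W z)⁻¹ := fun z ↦ by
    refine (Matrix.inv_eq_left_inv ?_).symm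
    rw [← hUz, ← evalAt_mul, hUU', evalAt_one]
  -- (S5) the conjugated family
  let Q₁I : Matrix (Fin q₁.size) (Fin q₁.size) C(X × I, ℂ) := (q₁.mat.map φ).map (comapRingHom ContinuousMap.fst)
  let R : Matrix (Fin q₁.size) (Fin q₁.size) C(X × I, ℂ) := Ui * Q₁I * Um
  have hQ₁ : IsIdempotentElem (q₁.mat.map φ) := q₁.isIdempotentElem.map (RingHom.mapMatrix φ)
  have hQ₁I : IsIdempotentElem Q₁I := hQ₁.map (RingHom.mapMatrix _)
  have hRidem : IsIdempotentElem R := by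
    change Ui * Q₁I * Um * (Ui * Q₁I * Um) = Ui * Q₁I * Um
    calc Ui * Q₁I * Um * (Ui * Q₁I * Um) = Ui * Q₁I * (Um * Ui) * Q₁I * Um := by simp only [Matrix.mul_assoc]
      _ = Ui * Q₁I * Um := by rw [hUU, Matrix.mul_one, Matrix.mul_assoc Ui Q₁I Q₁I, hQ₁I.eq]
  have hQ₁Iz : ∀ (a : X), a ∈ A → ∀ t : I, evalAt Q₁I (a, t) = E₁ := fun a ha t ↦ by
    change ((q₁.mat.map φ).map (comapRingHom ContinuousMap.fst)).map (evalRingHom (a, t)) = E₁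
    rw [Matrix.map_map]
    exact map_mk_map_eval q₁.mat ha
  have hRz : ∀ (a : X), a ∈ A → ∀ t : I, evalAt R (a, t) = E₁ := fun a ha t ↦ by
    change evalAt (Ui * Q₁I * Um) (a, t) = E₁
    rw [evalAt_mul, evalAt_mul, hUinvz, hUz, hQ₁Iz a ha t, hWk ⟨a, ha⟩ t, Matrix.mul_assoc, ← (hk ⟨a, ha⟩ t).2, ← Matrix.mul_assoc,
      Matrix.nonsing_inv_mul _ (hk ⟨a, ha⟩ t).1, Matrix.one_mul]
  have hRconst : ∀ i j, ∀ a ∈ A, ∀ t : I, R i j (a, t) = R i j (a₀, t) := fun i j a ha t ↦ by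
    have h1 := congrFun (congrFun (hRz a ha t) i) j
    have h2 := congrFun (congrFun (hRz a₀ ha₀ t) i) j
    exact h1.trans h2.symm
  -- (S6) descend to `X/A × [0,1]`; slices are homotopic
  let ρI : Idem C(Collapse X A × I, ℂ) := ⟨q₁.size, descendIMat R a₀ hRconst, isIdempotentElem_descendIMat hRidem a₀ hRconst⟩
  let rM : I → Matrix (Fin q₁.size) (Fin q₁.size) C(Collapse X A, ℂ) := fun t ↦ (descendIMat R a₀ hRconst).map (comapRingHom (sliceIncl t))
  have hhom : AlgEquivalent (rM 0) (rM 1) :=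
    Idem.equiv_iff.1 (map_comapRingHom_equiv_of_homotopic (sliceIncl_homotopic 0 1) ρI)
  -- slices of `U`
  have hUsl : ∀ t : I, Um.map (comapRingHom (sliceIncl t)) * Ui.map (comapRingHom (sliceIncl t)) = 1 := fun t ↦ by
    rw [← Matrix.map_mul, hUU, Matrix.map_one _ (map_zero _) (map_one _)]
  have hUsl' : ∀ t : I, Ui.map (comapRingHom (sliceIncl t)) * Um.map (comapRingHom (sliceIncl t)) = 1 := fun t ↦ by
    rw [← Matrix.map_mul, hUU', Matrix.map_one _ (map_zero _) (map_one _)]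
  have hQsl : ∀ t : I, Q₁I.map (comapRingHom (sliceIncl (X := X) t)) = q₁.mat.map φ := fun t ↦ by
    change ((q₁.mat.map φ).map (comapRingHom ContinuousMap.fst)).map (comapRingHom (sliceIncl t)) = q₁.mat.map φ
    rw [Matrix.map_map]; ext i j x; rfl
  have hRsl : ∀ t : I, (rM t).map φ = Ui.map (comapRingHom (sliceIncl t)) * q₁.mat.map φ * Um.map (comapRingHom (sliceIncl t)) := fun t ↦ by
    change ((descendIMat R a₀ hRconst).map (comapRingHom (sliceIncl t))).map (comapRingHom (Collapse.mk A)) = _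
    rw [descendIMat_slice_map_mk]
    change (Ui * Q₁I * Um).map (comapRingHom (sliceIncl t)) = _
    rw [Matrix.map_mul, Matrix.map_mul, hQsl]
  have hRpt : ∀ t : I, (rM t).map (evalRingHom (Collapse.pt A)) = E₁ := fun t ↦ by
    change ((descendIMat R a₀ hRconst).map (comapRingHom (sliceIncl t))).map (evalRingHom (Collapse.pt A)) = E₁
    rw [descendIMat_slice_map_eval_pt]
    exact hRz a₀ ha₀ t
  -- values of the slices of `U` on `A`
  have hUslA : ∀ (t : I) (a : X) (ha : a ∈ A), (Um.map (comapRingHom (sliceIncl t))).map (evalRingHom a) = k (⟨a, ha⟩, t) := fun t a ha ↦ by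
    rw [Matrix.map_map, ← hWk ⟨a, ha⟩ t, ← hUz]; rfl
  have hUslA' : ∀ (t : I) (a : X) (ha : a ∈ A), (Ui.map (comapRingHom (sliceIncl t))).map (evalRingHom a) = (k (⟨a, ha⟩, t))⁻¹ := fun t a ha ↦ by
    refine (Matrix.inv_eq_left_inv ?_).symm
    rw [← hUslA t a ha, ← Matrix.map_mul, hUsl' t, Matrix.map_one _ (map_zero _) (map_one _)]
  -- (S7) slice `0`: a conjugate of `q₁`
  have hW₀A : ∀ i j, ∀ a ∈ A, (Um.map (comapRingHom (sliceIncl 0))) i j a = (1 : Matrix (Fin q₁.size) (Fin q₁.size) ℂ) i j := fun i j a ha ↦ by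
    have := congrFun (congrFun (hUslA 0 a ha) i) j
    rw [hk0] at this
    exact this
  have hW₀'A : ∀ i j, ∀ a ∈ A, (Ui.map (comapRingHom (sliceIncl 0))) i j a = (1 : Matrix (Fin q₁.size) (Fin q₁.size) ℂ) i j := fun i j a ha ↦ by
    have := congrFun (congrFun (hUslA' 0 a ha) i) j
    rw [hk0, inv_one] at this
    exact this
  let ω₀ : Matrix (Fin q₁.size) (Fin q₁.size) C(Collapse X A, ℂ) := descendMatrix (Um.map (comapRingHom (sliceIncl 0))) 1 hW₀A
  let ω₀' : Matrix (Fin q₁.size) (Fin q₁.size) C(Collapse X A, ℂ) := descendMatrix (Ui.map (comapRingHom (sliceIncl 0))) 1 hW₀'A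
  have hω₀ : ω₀ * ω₀' = 1 := matrix_eq_of_map_mk_eq (by rw [Matrix.map_mul, descendMatrix_map_mk, descendMatrix_map_mk, hUsl 0, Matrix.map_one _ (map_zero _) (map_one _)])
    (by rw [Matrix.map_mul, descendMatrix_map_eval_pt, descendMatrix_map_eval_pt, Matrix.one_mul, Matrix.map_one _ (map_zero _) (map_one _)])
  have hω₀' : ω₀' * ω₀ = 1 := matrix_eq_of_map_mk_eq (by rw [Matrix.map_mul, descendMatrix_map_mk, descendMatrix_map_mk, hUsl' 0, Matrix.map_one _ (map_zero _) (map_one _)])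
    (by rw [Matrix.map_mul, descendMatrix_map_eval_pt, descendMatrix_map_eval_pt, Matrix.one_mul, Matrix.map_one _ (map_zero _) (map_one _)])
  have hr₀ : rM 0 = ω₀' * q₁.mat * ω₀ := by
    refine matrix_eq_of_map_mk_eq ?_ ?_
    · rw [hRsl 0, Matrix.map_mul, Matrix.map_mul, descendMatrix_map_mk, descendMatrix_map_mk]
    · rw [hRpt 0, Matrix.map_mul, Matrix.map_mul, descendMatrix_map_eval_pt, descendMatrix_map_eval_pt, Matrix.one_mul, Matrix.mul_one]
  have step1 : AlgEquivalent q₁.mat (rM 0) := by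
    rw [hr₀]; exact (algEquivalent_conj' q₁.isIdempotentElem hω₀).symm
  -- (S8) slice `1`: equivalent to `q₂`
  have hevρ : ∀ (M : Matrix (Fin q₁.size) (Fin q₁.size) C(X, ℂ)) (a : (A : Set X)), evalAt (M.map ρ) a = M.map (evalRingHom (a : X)) := fun M a ↦ by
    rw [evalAt, Matrix.map_map]; rfl
  have hW₁ρ : (Um.map (comapRingHom (sliceIncl 1))).map ρ = u := by
    refine ext_evalAt fun a ↦ ?_
    rw [hevρ, hUslA 1 a a.2, hk1]; rfl
  have hW₁'ρ : (Ui.map (comapRingHom (sliceIncl 1))).map ρ = u' := by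
    have h1 : (Ui.map (comapRingHom (sliceIncl 1))).map ρ * u = 1 := by
      rw [← hW₁ρ, ← Matrix.map_mul, hUsl' 1, Matrix.map_one _ (map_zero _) (map_one _)]
    calc (Ui.map (comapRingHom (sliceIncl 1))).map ρ = (Ui.map (comapRingHom (sliceIncl 1))).map ρ * (u * u') := by rw [huu', Matrix.mul_one]
      _ = u' := by rw [← Matrix.mul_assoc, h1, Matrix.one_mul]
  -- the modified equivalence `(W⁻¹ x, y W)`, constant on `A`
  let x' : Matrix (Fin q₁.size) (Fin q₂.size) C(X, ℂ) := Ui.map (comapRingHom (sliceIncl 1)) * x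
  let y' : Matrix (Fin q₂.size) (Fin q₁.size) C(X, ℂ) := y * Um.map (comapRingHom (sliceIncl 1))
  have hx'ρ : x'.map ρ = x₀.map (constRingHom (A : Set X)) := by
    change (Ui.map (comapRingHom (sliceIncl 1)) * x).map ρ = _
    rw [Matrix.map_mul, hW₁'ρ, ← hux₀, ← Matrix.mul_assoc, hu'u, Matrix.one_mul]
  have hy'ρ : y'.map ρ = y₀.map (constRingHom (A : Set X)) := by
    change (y * Um.map (comapRingHom (sliceIncl 1))).map ρ = _
    rw [Matrix.map_mul, hW₁ρ, ← hy₀u', Matrix.mul_assoc, hu'u, Matrix.mul_one]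
  let ξ : Matrix (Fin q₁.size) (Fin q₂.size) C(Collapse X A, ℂ) := descendMatrix x' x₀ (apply_eq_of_map_resHom_eq hx'ρ)
  let υ : Matrix (Fin q₂.size) (Fin q₁.size) C(Collapse X A, ℂ) := descendMatrix y' y₀ (apply_eq_of_map_resHom_eq hy'ρ)
  have hxyW : x' * y' = (rM 1).map φ := by
    rw [hRsl 1, ← hxy]; change Ui.map _ * x * (y * Um.map _) = _; simp only [Matrix.mul_assoc]
  have hyxW : y' * x' = q₂.mat.map φ := by
    rw [← hyx]; change y * Um.map _ * (Ui.map _ * x) = _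
    rw [Matrix.mul_assoc, ← Matrix.mul_assoc (Um.map _), hUsl 1, Matrix.one_mul]
  have hx'n : x' * y' * x' = x' := by
    change Ui.map _ * x * (y * Um.map _) * (Ui.map _ * x) = Ui.map _ * x
    calc Ui.map (comapRingHom (sliceIncl 1)) * x * (y * Um.map (comapRingHom (sliceIncl 1))) * (Ui.map (comapRingHom (sliceIncl 1)) * x)
        = Ui.map (comapRingHom (sliceIncl 1)) * (x * y) * (Um.map (comapRingHom (sliceIncl 1)) * Ui.map (comapRingHom (sliceIncl 1))) * x := by
          simp only [Matrix.mul_assoc]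
      _ = Ui.map (comapRingHom (sliceIncl 1)) * x := by rw [hUsl 1, Matrix.mul_one, Matrix.mul_assoc, hx]
  have hy'n : y' * x' * y' = y' := by
    change y * Um.map _ * (Ui.map _ * x) * (y * Um.map _) = y * Um.map _
    calc y * Um.map (comapRingHom (sliceIncl 1)) * (Ui.map (comapRingHom (sliceIncl 1)) * x) * (y * Um.map (comapRingHom (sliceIncl 1)))
        = y * (Um.map (comapRingHom (sliceIncl 1)) * Ui.map (comapRingHom (sliceIncl 1))) * x * y * Um.map (comapRingHom (sliceIncl 1)) := by
          simp only [Matrix.mul_assoc]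
      _ = y * Um.map (comapRingHom (sliceIncl 1)) := by rw [hUsl 1, Matrix.mul_one, hy]
  have step3 : AlgEquivalent (rM 1) q₂.mat := by
    refine ⟨ξ, υ, ?_, ?_, ?_, ?_⟩
    · exact matrix_eq_of_map_mk_eq (by rw [Matrix.map_mul, descendMatrix_map_mk, descendMatrix_map_mk, hxyW])
        (by rw [Matrix.map_mul, descendMatrix_map_eval_pt, descendMatrix_map_eval_pt, hxy₀, hRpt 1])
    · exact matrix_eq_of_map_mk_eq (by rw [Matrix.map_mul, descendMatrix_map_mk, descendMatrix_map_mk, hyxW])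
        (by rw [Matrix.map_mul, descendMatrix_map_eval_pt, descendMatrix_map_eval_pt, hyx₀])
    · exact matrix_eq_of_map_mk_eq (by rw [Matrix.map_mul, Matrix.map_mul, descendMatrix_map_mk, descendMatrix_map_mk, hx'n])
        (by rw [Matrix.map_mul, Matrix.map_mul, descendMatrix_map_eval_pt, descendMatrix_map_eval_pt, hx₀])
    · exact matrix_eq_of_map_mk_eq (by rw [Matrix.map_mul, Matrix.map_mul, descendMatrix_map_mk, descendMatrix_map_mk, hy'n])
        (by rw [Matrix.map_mul, Matrix.map_mul, descendMatrix_map_eval_pt, descendMatrix_map_eval_pt, hy₀])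
  -- (S9)
  exact (step1.trans hhom).trans step3

end Injective

/-! ### `K⁰(X/A) ≅ K⁰(X)` -/

section KLevel

variable [ContractibleSpace (A : Set X)]

/-- **`mk^* : K⁰(X/A) → K⁰(X)` is injective** for `A` closed contractible. [cite: HusemollerFibreBundles1994, Ch. 10 Prop. 2.1] -/
theorem quotK_injective : Function.Injective (quotK A : K0 (Collapse X A) → K0 X) := by
  refine (injective_iff_map_eq_zero _).2 fun b hb ↦ ?_
  obtain ⟨q₁, q₂, rfl⟩ := KZero.exists_of_sub_of b
  rw [map_sub, sub_eq_zero, quotK, pullback_of, pullback_of] at hb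
  obtain ⟨r, hr⟩ := KZero.of_eq_of_iff_exists_unit.1 hb
  rw [sub_eq_zero]
  refine KZero.of_eq_of_iff_exists_unit.2 ⟨r, ?_⟩
  have h := algEquivalent_of_algEquivalent_map_mk (A := A) (Idem.unit r + q₁) (Idem.unit r + q₂) ?_
  · exact Idem.equiv_iff.2 h
  · have e : ∀ q : Idem C(Collapse X A, ℂ), ((Idem.unit r + q).map (comapRingHom (Collapse.mk A))) = Idem.unit r + q.map (comapRingHom (Collapse.mk A)) := fun q ↦ by
      rw [Idem.map_add, Idem.map_unit]
    have := Idem.equiv_iff.1 hr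
    rwa [← e, ← e] at this

/-- **`mk^* : K⁰(X/A) → K⁰(X)` is surjective** for `A` closed contractible. [cite: HusemollerFibreBundles1994, Ch. 10 Prop. 2.1] -/
theorem quotK_surjective : Function.Surjective (quotK A : K0 (Collapse X A) → K0 X) := fun a ↦ by
  obtain ⟨p, q, rfl⟩ := KZero.exists_of_sub_of a
  obtain ⟨p', hp'⟩ := exists_idem_collapse_of_contractible (A := A) p
  obtain ⟨q', hq'⟩ := exists_idem_collapse_of_contractible (A := A) q
  refine ⟨KZero.of p' - KZero.of q', ?_⟩
  rw [map_sub, quotK, pullback_of, pullback_of, KZero.of_eq_of (p := p'.map (comapRingHom (Collapse.mk A))) (q := p) hp',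
    KZero.of_eq_of (p := q'.map (comapRingHom (Collapse.mk A))) (q := q) hq']

variable (A) in
/-- **`K⁰(X/A) ≅ K⁰(X)` when `A` is closed and contractible** (Hatcher, VBKT Lemma 2.10). [cite: HusemollerFibreBundles1994, Ch. 10 Prop. 2.1] -/
def quotKEquiv : K0 (Collapse X A) ≃+ K0 X := AddEquiv.ofBijective (quotK A) ⟨quotK_injective, quotK_surjective⟩

/-- Auxiliary statement for collapsing a contractible subspace. [folklore] -/
@[simp] theorem quotKEquiv_apply (b : K0 (Collapse X A)) : quotKEquiv A b = quotK A b := rfl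

omit [CompactSpace X] [T2Space X] [ContractibleSpace (A : Set X)] in
/-- The isomorphism restricts to reduced groups: `K̃(X/A) ≅ K̃(X)` (based at a point of `A`). [cite: HusemollerFibreBundles1994, Ch. 10 Prop. 2.1] -/
theorem quotK_mem_reduced_iff {a : X} (ha : a ∈ A) (b : K0 (Collapse X A)) : quotK A b ∈ Reduced X a ↔ b ∈ Reduced (Collapse X A) (Collapse.pt A) := by
  rw [mem_reduced_iff, mem_reduced_iff, quotK, rankAt_pullback, Collapse.mk_eq_pt ha]

end KLevel

end Literature.AlgebraicTopology.KTheory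

end
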